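import Summits.HodgeConjecture.CorCM.IrreducibleOddWeightsOrbitBalanceQuadratic
import HarnessLib

/-!
# Two CM fields whose Galois closures meet EXACTLY in an imaginary quadratic field `k`: `Hg(A₀ × A₁) = Hg(A₀) × Hg(A₁)`
# iff ONE of the two types has signature defect zero on `k` — the exact criterion, and the mixed exceptional classes

COR-CM (cell `pub-hodgecm2`, binder seat `b16` gen 62, count-neutral claim ORBIT BALANCE, file O8 — CM fields and
realisations; theorems only, no definition, no named fact, no `sorry`).  NEW as stated, hence under `Summits/`.  HONEST
FRAMING: unconditional statements about `dim MT(A₀ × A₁)` and about which Hodge classes on `A₀^a × A₁^b` are sums of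
products, plus one CONDITIONAL gluing statement; no Hodge class is claimed algebraic; `HC_CM` is neither used nor asserted.

SETTING.  Two-slot family `{i₀, i₁}`; an imaginary quadratic field `k` (`[k:ℚ] = 2`, totally complex) embedded in BOTH
CM fields, `j₀ : k → K_{i₀}`, `j₁ : k → K_{i₁}`, with a complex embedding `ι₀`; the Galois closures `L₀`, `L₁ ⊂ ℂ` meet
INSIDE `ι₀(k)` (hence exactly in `ι₀(k)`): `L₀ ∩ L₁ ⊆ ι₀(k)`.  `d_κ = Σ_{φ ∈ Φ_{i_κ}} sign(φ|_k)` the signature defects.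
File O5 was the case `K_{i₁} = k` (`A₁ = E_k`, `d₁ = ±1`).

* **`cmFamilyRank_add_card_eq_pair_iff_of_inf_le_quadratic`** — `Hg(A₀ × A₁) = Hg(A₀) × Hg(A₁)` **iff `d₀ = 0` or
  `d₁ = 0`**.  (⟸) a type with defect zero is equidistributed over `k`, and `k` is a Galois pivot containing `L₀ ∩ L₁`
  (file O3 `cmFamilyRank_add_card_eq_of_pairwise_pivot`); (⟹) the tree's `cmFamilyRank_add_card_lt_of_shared_quadratic`
  (both defects non-zero ⟹ the Weil-type obstruction).  One-sided forms `…_of_sum_ksign_eq_zero_left/right`.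
* **`forall_hodgeClassesProductSpan_pair_iff_of_inf_le_quadratic`** — for realisations: every rational Hodge class on
  every `A₀^a × A₁^b` (disjoint slot maps) is a sum of exterior products of Hodge classes of the factors **iff `d₀ = 0` or
  `d₁ = 0`**; `exists_not_hodgeClassesProductSpan_pair_of_sum_ksign_ne_zero₂` (both non-zero ⟹ a MIXED exceptional class);
  `hodgeConjectureFor_biproduct_pair_of_sum_ksign_eq_zero_of_powSucc₂` (one defect zero: the Hodge conjecture for the powers
  of both members gives it on all `A₀^a × A₁^b`).
* In all cases the pair is DEGENERATE (tree `not_isNondegenerateFamily_of_shared_imaginary_quadratic`): the question decided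
  here is whether the degeneracy is MIXED.  Examples: `K₀ = k·F₀`, `K₁ = k·F₁` with totally real `F₀`, `F₁` whose Galois
  closures are linearly disjoint from each other over `ℚ` (then `L₀ ∩ L₁ = ι₀(k)`); two cyclic sextic CM fields through
  `k` with different cubic subfields.

## References

* [MoonenZarhin1999LowDim] B. Moonen, Yu. Zarhin, *Hodge classes on abelian varieties of low dimension*, Math. Ann.
  315 (1999), Thm. (0.1) (a), §3 (3.1).
* [Gordon1999HodgeAVSurvey] B. B. Gordon, *A survey of the Hodge conjecture for abelian varieties*, §3 Theorem (proof),
  7.5–7.7, 9.4.3.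
* [Deligne1982HodgeCycles] P. Deligne, *Hodge cycles on abelian varieties*, LNM 900 (1982), §4 (Weil classes).
* [Lang2002] S. Lang, *Algebra*, VI §1 Thm. 1.14 (Galois closures and their intersection).
-/

set_option autoImplicit false

noncomputable section

open scoped BigOperators Classical

open CategoryTheory CategoryTheory.Limits NumberField Module IntermediateField

namespace Summit.HodgeConjecture.CorCM

open Literature.NumberTheory.ComplexMultiplication
open Literature.AlgebraicGeometry.Motives (AbelianVariety CMType)
open Literature.AlgebraicGeometry.Motives.AbelianVariety
open Literature.AlgebraicGeometry.HodgeTheory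
open Literature.AlgebraicGeometry.ComplexMultiplication (IsCMTypeRealisation)
open Literature.AlgebraicGeometry.Pohlmann1968

variable {I : Type} [Fintype I] {K : I → Type} [∀ i, Field (K i)] [∀ i, NumberField (K i)] [∀ i, IsCMField (K i)]
  {k : Type} [Field k] [NumberField k] [IsTotallyComplex k]

/-! ### §1 The rank criterion -/

section Rank

/-- **Defect zero on the FIRST slot ⟹ additive** (the closures meeting inside `ι₀(k)`).
[cite: Gordon1999HodgeAVSurvey, §3 Theorem (proof), 7.7 and 9.4.3] [cite: Deligne1982HodgeCycles, §4] -/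
theorem cmFamilyRank_add_card_eq_pair_of_sum_ksign_eq_zero_left {i₀ i₁ : I} (h01 : i₀ ≠ i₁) (hI : ∀ l, l = i₀ ∨ l = i₁)
    (hk : finrank ℚ k = 2) (ι₀ : k →+* ℂ) (j₀ : k →+* K i₀) (Φ : ∀ i, CMType (K i))
    (hmeet : ∀ z : ℂ, z ∈ normalClosure ℚ (K i₀) ℂ → z ∈ normalClosure ℚ (K i₁) ℂ → z ∈ Set.range ι₀)
    (hd₀ : ∑ φ ∈ Finset.univ.filter (fun φ : K i₀ →+* ℂ => φ ∈ (Φ i₀).1), (if φ.comp j₀ = ι₀ then (1 : ℚ) else -1) = 0) :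
    CMAlgebra.cmFamilyRank Φ + Fintype.card I = (∑ i, cmTypeRank (Φ i)) + 1 := by
  haveI : Nonempty I := ⟨i₀⟩
  haveI : Normal ℚ k := normal_of_finrank_eq_two hk
  have hbal := shadow_eq_zero_of_sum_ksign_eq_zero hk ι₀ j₀ (Φ i₀) hd₀
  refine cmFamilyRank_add_card_eq_of_pairwise_pivot Φ fun i i' hii' => ?_
  rcases hI i with rfl | rfl <;> rcases hI i' with rfl | rfl
  · exact absurd rfl hii'
  · exact Or.inl ⟨k, inferInstance, inferInstance, inferInstance, j₀, ι₀, hmeet, hbal⟩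
  · exact Or.inr ⟨k, inferInstance, inferInstance, inferInstance, j₀, ι₀, hmeet, hbal⟩
  · exact absurd rfl hii'

/-- **Defect zero on the SECOND slot ⟹ additive** (symmetric form). [cite: Gordon1999HodgeAVSurvey, §3 Theorem (proof) and 9.4.3] -/
theorem cmFamilyRank_add_card_eq_pair_of_sum_ksign_eq_zero_right {i₀ i₁ : I} (h01 : i₀ ≠ i₁) (hI : ∀ l, l = i₀ ∨ l = i₁)
    (hk : finrank ℚ k = 2) (ι₀ : k →+* ℂ) (j₁ : k →+* K i₁) (Φ : ∀ i, CMType (K i))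
    (hmeet : ∀ z : ℂ, z ∈ normalClosure ℚ (K i₀) ℂ → z ∈ normalClosure ℚ (K i₁) ℂ → z ∈ Set.range ι₀)
    (hd₁ : ∑ φ ∈ Finset.univ.filter (fun φ : K i₁ →+* ℂ => φ ∈ (Φ i₁).1), (if φ.comp j₁ = ι₀ then (1 : ℚ) else -1) = 0) :
    CMAlgebra.cmFamilyRank Φ + Fintype.card I = (∑ i, cmTypeRank (Φ i)) + 1 :=
  cmFamilyRank_add_card_eq_pair_of_sum_ksign_eq_zero_left h01.symm (fun l => (hI l).symm) hk ι₀ j₁ Φ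
    (fun z h₁ h₀ => hmeet z h₀ h₁) hd₁

/-- **THE EXACT CRITERION for two CM fields whose Galois closures meet inside an imaginary quadratic field `k`:
`Hg(A₀ × A₁) = Hg(A₀) × Hg(A₁)` iff one of the two signature defects on `k` vanishes.**
[cite: Gordon1999HodgeAVSurvey, §3 Theorem (proof), 7.5–7.7 and 9.4.3] [cite: Deligne1982HodgeCycles, §4] [cite: Lang2002, VI §1 Thm. 1.14] -/
theorem cmFamilyRank_add_card_eq_pair_iff_of_inf_le_quadratic {i₀ i₁ : I} (h01 : i₀ ≠ i₁) (hI : ∀ l, l = i₀ ∨ l = i₁)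
    (hk : finrank ℚ k = 2) (ι₀ : k →+* ℂ) (j₀ : k →+* K i₀) (j₁ : k →+* K i₁) (Φ : ∀ i, CMType (K i))
    (hmeet : ∀ z : ℂ, z ∈ normalClosure ℚ (K i₀) ℂ → z ∈ normalClosure ℚ (K i₁) ℂ → z ∈ Set.range ι₀) :
    CMAlgebra.cmFamilyRank Φ + Fintype.card I = (∑ i, cmTypeRank (Φ i)) + 1 ↔
      (∑ φ ∈ Finset.univ.filter (fun φ : K i₀ →+* ℂ => φ ∈ (Φ i₀).1), (if φ.comp j₀ = ι₀ then (1 : ℚ) else -1) = 0 ∨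
        ∑ φ ∈ Finset.univ.filter (fun φ : K i₁ →+* ℂ => φ ∈ (Φ i₁).1), (if φ.comp j₁ = ι₀ then (1 : ℚ) else -1) = 0) := by
  haveI : Nonempty I := ⟨i₀⟩
  refine ⟨fun h => ?_, fun h => ?_⟩
  · by_contra hne
    push Not at hne
    exact absurd h (ne_of_lt (cmFamilyRank_add_card_lt_of_shared_quadratic hk ι₀ h01 j₀ j₁ Φ hne.1 hne.2))
  · rcases h with h | h
    · exact cmFamilyRank_add_card_eq_pair_of_sum_ksign_eq_zero_left h01 hI hk ι₀ j₀ Φ hmeet h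
    · exact cmFamilyRank_add_card_eq_pair_of_sum_ksign_eq_zero_right h01 hI hk ι₀ j₁ Φ hmeet h

/-- In all cases the pair is DEGENERATE (the tree's theorem for a shared imaginary quadratic field): the criterion decides
whether the degeneracy is MIXED. [cite: Gordon1999HodgeAVSurvey, 7.5–7.6.1 and 9.4.3] -/
theorem not_isNondegenerateFamily_pair_of_shared_quadratic {i₀ i₁ : I} (h01 : i₀ ≠ i₁) (hk : finrank ℚ k = 2)
    (j₀ : k →+* K i₀) (j₁ : k →+* K i₁) (Φ : ∀ i, CMType (K i)) : ¬ CMAlgebra.IsNondegenerateFamily Φ :=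
  not_isNondegenerateFamily_of_shared_imaginary_quadratic hk h01 j₀ j₁ Φ

end Rank

/-! ### §2 Realisations -/

section Hodge

variable {Φ : ∀ i, CMType (K i)} {A : I → AbelianVariety ℂ} {ιA : ∀ i, 𝓞 (K i) →+* End (A i)}
  {θ : ∀ i, K i →+* Module.End ℂ (complexBetti (A i).X 1)}

/-- **EVERY HODGE CLASS ON EVERY `A₀^a × A₁^b` IS A SUM OF PRODUCTS ⟺ ONE DEFECT VANISHES** (closures meeting inside `k`;
the left side quantifies over all disjoint slot maps). [cite: MoonenZarhin1999LowDim, Thm. (0.1) (a) and §3 (3.1)]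
[cite: Gordon1999HodgeAVSurvey, 7.5–7.7 and 9.4.3] -/
theorem forall_hodgeClassesProductSpan_pair_iff_of_inf_le_quadratic {i₀ i₁ : I} (h01 : i₀ ≠ i₁)
    (hI : ∀ l, l = i₀ ∨ l = i₁) (hk : finrank ℚ k = 2) (ι₀ : k →+* ℂ) (j₀ : k →+* K i₀) (j₁ : k →+* K i₁)
    (hmeet : ∀ z : ℂ, z ∈ normalClosure ℚ (K i₀) ℂ → z ∈ normalClosure ℚ (K i₁) ℂ → z ∈ Set.range ι₀)
    (hA : ∀ i, IsCMTypeRealisation (Φ i) (A i) (ιA i) (θ i)) :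
    (∀ (N₁ N₂ : ℕ) [NeZero N₁] [NeZero N₂] (π₁ : Fin N₁ → I) (π₂ : Fin N₂ → I), (∀ l₁ l₂, π₁ l₁ ≠ π₂ l₂) →
        HodgeClassesProductSpan (⨁ fun l => A (π₁ l)) (⨁ fun l => A (π₂ l))) ↔
      (∑ φ ∈ Finset.univ.filter (fun φ : K i₀ →+* ℂ => φ ∈ (Φ i₀).1), (if φ.comp j₀ = ι₀ then (1 : ℚ) else -1) = 0 ∨
        ∑ φ ∈ Finset.univ.filter (fun φ : K i₁ →+* ℂ => φ ∈ (Φ i₁).1), (if φ.comp j₁ = ι₀ then (1 : ℚ) else -1) = 0) := by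
  haveI : Nonempty I := ⟨i₀⟩
  exact (cmFamilyRank_add_card_eq_iff_forall_hodgeClassesProductSpan hA).symm.trans
    (cmFamilyRank_add_card_eq_pair_iff_of_inf_le_quadratic h01 hI hk ι₀ j₀ j₁ Φ hmeet)

/-- **Both defects non-zero ⟹ a MIXED exceptional Hodge class** on some `(⨁_l A_{π₁ l}) × (⨁_l A_{π₂ l})` with disjoint
slot maps (the Weil classes of `k`) — whatever the closures. [cite: MoonenZarhin1999LowDim, Thm. (0.1) (a)] [cite: Deligne1982HodgeCycles, §4] -/
theorem exists_not_hodgeClassesProductSpan_pair_of_sum_ksign_ne_zero₂ {i₀ i₁ : I} (h01 : i₀ ≠ i₁)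
    (hk : finrank ℚ k = 2) (ι₀ : k →+* ℂ) (j₀ : k →+* K i₀) (j₁ : k →+* K i₁)
    (hA : ∀ i, IsCMTypeRealisation (Φ i) (A i) (ιA i) (θ i))
    (hd₀ : ∑ φ ∈ Finset.univ.filter (fun φ : K i₀ →+* ℂ => φ ∈ (Φ i₀).1), (if φ.comp j₀ = ι₀ then (1 : ℚ) else -1) ≠ 0)
    (hd₁ : ∑ φ ∈ Finset.univ.filter (fun φ : K i₁ →+* ℂ => φ ∈ (Φ i₁).1), (if φ.comp j₁ = ι₀ then (1 : ℚ) else -1) ≠ 0) :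
    ∃ (N₁ N₂ : ℕ) (_ : NeZero N₁) (_ : NeZero N₂) (π₁ : Fin N₁ → I) (π₂ : Fin N₂ → I),
      (∀ l₁ l₂, π₁ l₁ ≠ π₂ l₂) ∧ ¬ HodgeClassesProductSpan (⨁ fun l => A (π₁ l)) (⨁ fun l => A (π₂ l)) := by
  haveI : Nonempty I := ⟨i₀⟩
  exact exists_not_hodgeClassesProductSpan_of_cmFamilyRank_add_card_ne hA
    (ne_of_lt (cmFamilyRank_add_card_lt_of_shared_quadratic hk ι₀ h01 j₀ j₁ Φ hd₀ hd₁))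

/-- **One defect zero (closures meeting inside `k`): the Hodge conjecture for the powers of both members gives it on every
`A₀^a × A₁^b`.** [cite: MoonenZarhin1999LowDim, §3 (3.1)] [cite: vanGeemen1994HodgeAV, §3.5–3.7 Lemma 3.7 (p. 236)] -/
theorem hodgeConjectureFor_biproduct_pair_of_sum_ksign_eq_zero_of_powSucc₂ {i₀ i₁ : I} (h01 : i₀ ≠ i₁)
    (hI : ∀ l, l = i₀ ∨ l = i₁) (hk : finrank ℚ k = 2) (ι₀ : k →+* ℂ) (j₀ : k →+* K i₀) (j₁ : k →+* K i₁)
    (hmeet : ∀ z : ℂ, z ∈ normalClosure ℚ (K i₀) ℂ → z ∈ normalClosure ℚ (K i₁) ℂ → z ∈ Set.range ι₀)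
    (hd : ∑ φ ∈ Finset.univ.filter (fun φ : K i₀ →+* ℂ => φ ∈ (Φ i₀).1), (if φ.comp j₀ = ι₀ then (1 : ℚ) else -1) = 0 ∨
      ∑ φ ∈ Finset.univ.filter (fun φ : K i₁ →+* ℂ => φ ∈ (Φ i₁).1), (if φ.comp j₁ = ι₀ then (1 : ℚ) else -1) = 0)
    (hA : ∀ i, IsCMTypeRealisation (Φ i) (A i) (ιA i) (θ i))
    (hHC : ∀ (i : I) (N : ℕ), HodgeConjectureFor ((A i).powSucc N).dim ((A i).powSucc N).X)
    {J : Type} [Fintype J] [Nonempty J] (π : J → I) :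
    HodgeConjectureFor (⨁ fun l => A (π l)).dim (⨁ fun l => A (π l)).X :=
  hodgeConjectureFor_biproduct_of_cmFamilyRank_add_card_eq
    ((cmFamilyRank_add_card_eq_pair_iff_of_inf_le_quadratic h01 hI hk ι₀ j₀ j₁ Φ hmeet).2 hd) hA hHC π

end Hodge

end Summit.HodgeConjecture.CorCM

end
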